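import Literature.NumberTheory.LFunctions.BurnolAdelicCausalityProofs
import Literature.NumberTheory.LFunctions.NymanBeurlingProofs
import Mathlib.MeasureTheory.Integral.Prod
import Mathlib.MeasureTheory.Function.Floor
import HarnessLib

/-!
# Burnol 2001, Thm 2.4 — the RH-FREE half: if the dilates of `A` span `L²(0,1)` then RH

LABEL (line 1): RH-FREE door theorem. `Literature.NumberTheory.LFunctions.Burnol2001_thm_2_4` is
an RH-EQUIVALENT·PRINTED criterion (`RH ↔ the dilates U(λ)A, 0 < λ ≤ 1, span L²((0,1))`); its
`⟹` half needs the outer/inner factorisation theory of the Hardy space `H²` of a half-plane (cell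
boundary F8, not in Mathlib) and stays a named fact. This file PROVES the `⟸` half AS PRINTED:
`(dilates of A span L²(0,1)) → RiemannHypothesis` — an implication INTO RH from a closure
property nobody asserts. bears_on: LADDER-RH B-C/B-P (COLUMN 6 DBR). WHAT THIS IS NOT: a proof
or disproof of RH; a door fixes WHICH closure statement would prove RH, it does not move RH;
nothing here bears on the truth of RH.

Source: J.-F. Burnol, J. Number Theory 87 (2001) 253–269 = arXiv:math/0001013v3 [Burnol2001], §2,
the paragraph before Thm 2.4 (TeX l.391–405) and Thm 2.4 (l.407–410).

## The printed computation, followed here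

Burnol (l.391–400): "As `∫_0^1 {1/u} u^{s−1} du = 1/(s−1) − ζ(s)/s` … The unitary operator `V` …
acts as `f(u) ↦ f(u) − ∫_u^∞ f(t) dt/t`. As `ζ(s)/s = −∫_0^∞ {1/u} u^{s−1} du` (for
`0 < Re(s) < 1`) we obtain after a straightforward computation:
`((s−1)/s)·(ζ(s)/s) = ∫_0^1 A(u) u^{s−1} du`, `A(u) = [1/u] log(u) + log([1/u]!) + [1/u]`."

We formalise exactly this:
* `Burnol2001.hasMellin_integral_Ioi_div`: the spectral action of `V` — for `f` Mellin-integrable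
  at `s`, `Re s > 0`, `∫_0^∞ (∫_u^∞ f(v) dv/v) u^{s−1} du = (1/s) ∫_0^∞ f(v) v^{s−1} dv` (Fubini on
  the wedge `0 < u < v`), so `(Vf)^(s) = ((s−1)/s) f̂(s)`.
* `Burnol2001.fnA_eq`: the "straightforward computation" `A = V(−{1/u})` pointwise on `(0, ∞)`
  (`∫_u^∞ {1/v} dv/v = 1/u + [1/u] log u + log([1/u]!)`, by `[1/v] = Σ_m 𝟙[v ≤ 1/(m+1)]`).
* `Burnol2001.hasMellin_fnA`: `Â(s) = (s−1)ζ(s)/s²` for `0 < Re s < 1`, from the tree's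
  Titchmarsh (2.1.5) `mellin_fract_one_div_eq` (`∫_0^∞ {1/t} t^{s−1} dt = −ζ(s)/s`). No Stirling
  estimate is needed.
* `riemannHypothesis_of_dilate_fnA_closure`: at a zero `s₀` of `ζ` with `½ < Re s₀ < 1` every
  dilate `U(λ)A` (`(U(λ)A)^(s) = λ^{s−1/2} Â(s)`, `mellin_comp_mul_left`) is Mellin-orthogonal to
  `u^{s₀−1} ∈ L²(0,1)`, while `∫_0^1 u^{s₀−1} du = 1/s₀ ≠ 0`; Cauchy–Schwarz and `ε → 0`; zeros left
  of the line by `quasiRiemannHypothesis_one_half_iff_holds` — the same closing argument as for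
  Nyman's criterion (`riemannHypothesis_of_nyman_closure`).

No new definitions, no new named facts (net debt 0: a half of an iff).

## References
* [Burnol2001] J.-F. Burnol, *An adelic causality problem related to abelian L-functions*,
  J. Number Theory 87 (2001) 253–269 = arXiv:math/0001013v3, Thm 2.4 and l.391–405.
* [Titchmarsh1986] E. C. Titchmarsh, *The Theory of the Riemann Zeta-Function*, 2nd ed., §2.1
  (2.1.5) (the tree's `mellin_fract_one_div_eq`).
-/

noncomputable section

open Complex Filter MeasureTheory Set Asymptotics
open scoped Real Topology

namespace Literature.NumberTheory.LFunctions

namespace Burnol2001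

/-! ## The spectral action of `V`: `(∫_u^∞ f dv/v)^(s) = f̂(s)/s` -/

/-- **Mellin transform of `u ↦ ∫_u^∞ f(v) dv/v`** (the integral part of Burnol's `V`): if `f` is
Mellin-integrable at `s` with `Re s > 0`, then `u ↦ ∫_u^∞ f(v) dv/v` is Mellin-integrable at `s`
with transform `f̂(s)/s` (Fubini on the wedge `0 < u < v`: `∫_0^v u^{s−1} du = v^s/s`). Hence
`(Vf)^(s) = (1 − 1/s) f̂(s) = ((s−1)/s) f̂(s)`, Burnol's "multiplier `(s−1)/s` in the spectral
representation". [cite: Burnol2001, §2 (before Thm 2.4), TeX l.393–396; Def 1.8] -/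
theorem hasMellin_integral_Ioi_div {f : ℝ → ℂ} {s : ℂ} (hs : 0 < s.re)
    (hfm : AEStronglyMeasurable f (volume.restrict (Ioi (0 : ℝ)))) (hf : MellinConvergent f s) :
    HasMellin (fun u : ℝ ↦ ∫ v in Ioi u, f v / v) s (mellin f s / s) := by
  set μ0 : Measure ℝ := volume.restrict (Ioi (0 : ℝ)) with hμ0
  have hs0 : s ≠ 0 := fun h ↦ by simp [h] at hs
  -- the kernel on the wedge `0 < u < v`
  set g : ℝ → ℝ → ℂ := fun u v ↦ if u < v then (u : ℂ) ^ (s - 1) * (f v / v) else 0 with hg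
  have hGm : AEStronglyMeasurable (Function.uncurry g) (μ0.prod μ0) := by
    have h1 : AEStronglyMeasurable (fun p : ℝ × ℝ ↦ (p.1 : ℂ) ^ (s - 1) * (f p.2 / p.2))
        (μ0.prod μ0) := by
      refine (((Complex.measurable_ofReal.comp measurable_fst).pow_const _).aestronglyMeasurable).mul ?_
      exact hfm.comp_snd.mul
        ((Complex.measurable_ofReal.comp measurable_snd).inv.aestronglyMeasurable)
    refine (h1.indicator (measurableSet_lt measurable_fst measurable_snd)).congr
      (Eventually.of_forall fun p ↦ ?_)
    rcases p with ⟨u, v⟩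
    simp only [Function.uncurry_apply_pair, hg, Set.indicator_apply, mem_setOf_eq, div_eq_mul_inv]
  -- `∫_0^v ‖u^{s-1}‖ du = v^σ/σ`
  have hIoc : ∀ v : ℝ, 0 < v →
      IntegrableOn (fun u : ℝ ↦ (u : ℂ) ^ (s - 1)) (Ioc 0 v) ∧
        ∫ u in Ioc 0 v, ‖(u : ℂ) ^ (s - 1)‖ = v ^ s.re / s.re := by
    intro v hv
    have h1 : IntervalIntegrable (fun u : ℝ ↦ (u : ℂ) ^ (s - 1)) volume 0 v := by
      refine intervalIntegral.intervalIntegrable_cpow' ?_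
      simp only [sub_re, one_re]; linarith
    refine ⟨(intervalIntegrable_iff_integrableOn_Ioc_of_le hv.le).1 h1, ?_⟩
    have h2 : ∫ u in Ioc 0 v, ‖(u : ℂ) ^ (s - 1)‖ = ∫ u in Ioc 0 v, u ^ (s.re - 1) := by
      refine setIntegral_congr_fun measurableSet_Ioc fun u hu ↦ ?_
      rw [norm_cpow_eq_rpow_re_of_pos hu.1, sub_re, one_re]
    rw [h2, ← intervalIntegral.integral_of_le hv.le, integral_rpow (Or.inl (by linarith)),
      Real.zero_rpow (by linarith), sub_zero, sub_add_cancel]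
  -- a.e. in `u`, the `u`-section of `g` is the indicator of `(0, v]`
  have hgv : ∀ v : ℝ, 0 < v → (fun u ↦ g u v) =ᵐ[μ0]
      (Ioc (0 : ℝ) v).indicator (fun u : ℝ ↦ (u : ℂ) ^ (s - 1) * (f v / v)) := by
    intro v hv
    have hne : ∀ᵐ u ∂μ0, u ∈ ({v} : Set ℝ)ᶜ :=
      ae_mono Measure.restrict_le_self (compl_mem_ae_iff.2 (measure_singleton v))
    filter_upwards [ae_restrict_mem measurableSet_Ioi, hne] with u (hu : 0 < u) huv
    rw [mem_compl_singleton_iff] at huv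
    simp only [hg]
    by_cases h : u < v
    · rw [if_pos h, indicator_of_mem (Set.mem_Ioc.2 ⟨hu, h.le⟩)]
    · rw [if_neg h, indicator_of_notMem (fun h' ↦ h (lt_of_le_of_ne (Set.mem_Ioc.1 h').2 huv))]
  -- integrability on the product
  have hGint : Integrable (Function.uncurry g) (μ0.prod μ0) := by
    rw [integrable_prod_iff' hGm]
    constructor
    · filter_upwards [ae_restrict_mem measurableSet_Ioi] with v (hv : 0 < v)
      have h0 : IntegrableOn (fun u : ℝ ↦ (u : ℂ) ^ (s - 1) * (f v / v)) (Ioc 0 v) :=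
        (hIoc v hv).1.mul_const _
      have h1 : Integrable ((Ioc (0 : ℝ) v).indicator (fun u : ℝ ↦ (u : ℂ) ^ (s - 1) * (f v / v)))
          μ0 :=
        (h0.integrable_indicator measurableSet_Ioc).mono_measure Measure.restrict_le_self
      exact h1.congr (hgv v hv).symm
    · have heq : (fun v ↦ ∫ u, ‖Function.uncurry g (u, v)‖ ∂μ0) =ᵐ[μ0]
          fun v ↦ (1 / s.re) * ‖(v : ℂ) ^ (s - 1) • f v‖ := by
        filter_upwards [ae_restrict_mem measurableSet_Ioi] with v (hv : 0 < v)
        simp only [Function.uncurry_apply_pair]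
        have h1 : (fun u ↦ ‖g u v‖) =ᵐ[μ0]
            (Ioc (0 : ℝ) v).indicator (fun u : ℝ ↦ ‖(u : ℂ) ^ (s - 1)‖ * ‖f v / v‖) := by
          filter_upwards [hgv v hv] with u hu
          rw [hu, norm_indicator_eq_indicator_norm]
          simp only [norm_mul]
        rw [integral_congr_ae h1, integral_indicator measurableSet_Ioc, hμ0,
          Measure.restrict_restrict measurableSet_Ioc, inter_eq_left.2 Ioc_subset_Ioi_self,
          integral_mul_const, (hIoc v hv).2, norm_smul, norm_div, Complex.norm_real,
          Real.norm_eq_abs, abs_of_pos hv, norm_cpow_eq_rpow_re_of_pos hv, sub_re, one_re,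
          Real.rpow_sub_one hv.ne']
        field_simp
      rw [integrable_congr heq]
      exact hf.norm.const_mul _
  have hswap := integral_integral_swap hGint
  -- (i) `∫_v g u v = u^{s-1} ∫_{v>u} f v / v`
  have hinner_u : ∀ u : ℝ, 0 < u →
      ∫ v, g u v ∂μ0 = (u : ℂ) ^ (s - 1) * ∫ v in Ioi u, f v / v := by
    intro u hu
    have h1 : (fun v ↦ g u v) = (Ioi u).indicator (fun v ↦ (u : ℂ) ^ (s - 1) * (f v / v)) := by
      funext v
      simp only [hg, Set.indicator_apply, mem_Ioi]
    rw [h1, integral_indicator measurableSet_Ioi, hμ0, Measure.restrict_restrict measurableSet_Ioi,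
      Ioi_inter_Ioi, max_eq_left hu.le, integral_const_mul]
  -- (ii) `∫_u g u v = v^{s-1} f v / s`
  have hinner_v : ∀ v : ℝ, 0 < v → ∫ u, g u v ∂μ0 = (v : ℂ) ^ (s - 1) * f v / s := by
    intro v hv
    have hv' : (v : ℂ) ≠ 0 := by exact_mod_cast hv.ne'
    rw [integral_congr_ae (hgv v hv), integral_indicator measurableSet_Ioc, hμ0,
      Measure.restrict_restrict measurableSet_Ioc, inter_eq_left.2 Ioc_subset_Ioi_self,
      integral_mul_const]
    have h2 : ∫ u in Ioc 0 v, (u : ℂ) ^ (s - 1) = (v : ℂ) ^ s / s := by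
      have := (hasMellin_indicator_Ioc hv hs).2
      rw [mellin] at this
      rw [← this, ← integral_indicator measurableSet_Ioc, ← integral_indicator measurableSet_Ioi]
      refine integral_congr_ae (Eventually.of_forall fun u ↦ ?_)
      by_cases hu : u ∈ Ioc (0 : ℝ) v
      · rw [indicator_of_mem hu, indicator_of_mem (Ioc_subset_Ioi_self hu), indicator_of_mem hu,
          smul_eq_mul, mul_one]
      · rw [indicator_of_notMem hu]
        by_cases hu' : u ∈ Ioi (0 : ℝ)
        · rw [indicator_of_mem hu', indicator_of_notMem hu, smul_zero]
        · rw [indicator_of_notMem hu']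
    rw [h2, cpow_sub _ _ hv', cpow_one]
    field_simp
  -- assemble
  have hconv : MellinConvergent (fun u : ℝ ↦ ∫ v in Ioi u, f v / v) s := by
    have h1 : Integrable (fun u ↦ ∫ v, Function.uncurry g (u, v) ∂μ0) μ0 := hGint.integral_prod_left
    refine (h1.congr ?_)
    filter_upwards [ae_restrict_mem measurableSet_Ioi] with u (hu : 0 < u)
    simp only [Function.uncurry_apply_pair]
    rw [hinner_u u hu, smul_eq_mul]
  refine ⟨hconv, ?_⟩
  calc mellin (fun u : ℝ ↦ ∫ v in Ioi u, f v / v) s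
      = ∫ u, ∫ v, g u v ∂μ0 ∂μ0 := by
        rw [mellin]
        refine integral_congr_ae ?_
        filter_upwards [ae_restrict_mem measurableSet_Ioi] with u (hu : 0 < u)
        rw [hinner_u u hu, smul_eq_mul]
    _ = ∫ v, ∫ u, g u v ∂μ0 ∂μ0 := hswap
    _ = ∫ v in Ioi (0 : ℝ), (v : ℂ) ^ (s - 1) * f v / s := by
        refine integral_congr_ae ?_
        filter_upwards [ae_restrict_mem measurableSet_Ioi] with v (hv : 0 < v)
        exact hinner_v v hv
    _ = mellin f s / s := by
        rw [mellin, ← integral_div]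
        refine integral_congr_ae (Eventually.of_forall fun v ↦ ?_)
        simp only [smul_eq_mul]


/-! ## Counting: `⌊1/v⌋ = Σ_m 𝟙[(m+1)v ≤ 1]` (finite form) -/

/-- For `u > 0`, `a ≥ 0` and any `N ≥ ⌊a/u⌋`, `Σ_{n<N} 𝟙_{(0,a]}((n+1)u) = ⌊a/u⌋` (the version of
`sum_indicator_Ioc_eq_floor` with the sharp hypothesis). [cite: Burnol2001, §2 (before Thm 2.4),
`A(u) = [1/u] log u + log([1/u]!) + [1/u]`] -/
theorem sum_indicator_Ioc_eq_floor' {a u : ℝ} (ha : 0 ≤ a) (hu : 0 < u) {N : ℕ}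
    (hKN : ⌊a / u⌋₊ ≤ N) :
    ∑ n ∈ Finset.range N, (Ioc (0 : ℝ) a).indicator (fun _ ↦ (1 : ℝ)) ((n + 1 : ℕ) * u) =
      ⌊a / u⌋₊ := by
  set K := ⌊a / u⌋₊ with hK
  have hiff : ∀ n : ℕ, ((n + 1 : ℕ) : ℝ) * u ∈ Ioc (0 : ℝ) a ↔ n < K := by
    intro n
    rw [mem_Ioc, and_iff_right (by positivity), ← le_div_iff₀ hu, ← Nat.add_one_le_iff, hK,
      Nat.le_floor_iff (div_nonneg ha hu.le)]
  have hterm : ∀ n : ℕ, (Ioc (0 : ℝ) a).indicator (fun _ ↦ (1 : ℝ)) ((n + 1 : ℕ) * u) =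
      if n < K then 1 else 0 := by
    intro n
    by_cases hn : n < K
    · rw [if_pos hn, indicator_of_mem ((hiff n).2 hn)]
    · rw [if_neg hn, indicator_of_notMem ((hiff n).not.2 hn)]
  rw [Finset.sum_congr rfl fun n _ ↦ hterm n, ← Finset.sum_range_add_sum_Ico _ hKN,
    Finset.sum_congr rfl fun n hn ↦ if_pos (Finset.mem_range.1 hn),
    Finset.sum_congr rfl fun n hn ↦ if_neg (not_lt.2 (Finset.mem_Ico.1 hn).1)]
  simp

/-! ## The "straightforward computation": `A = V(−{1/u})` -/

/-- For `u > 0`, with `N = ⌊1/u⌋`: `∫_u^∞ {1/v} dv/v = 1/u + N log u + log N!` (split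
`{1/v}/v = v^{−2} − Σ_{m<N} 𝟙[v ≤ 1/(m+1)]/v` on `(u,∞)` and integrate each piece:
`∫_u^∞ v^{−2} dv = 1/u`, `∫_u^{1/(m+1)} dv/v = −log((m+1)u)`).
[cite: Burnol2001, §2 (before Thm 2.4), TeX l.396–400] -/
theorem integral_Ioi_fract_div {u : ℝ} (hu : 0 < u) :
    ∫ v in Ioi u, Int.fract (1 / v) / v =
      1 / u + ⌊1 / u⌋₊ * Real.log u + Real.log ((⌊1 / u⌋₊.factorial : ℕ) : ℝ) := by
  set N : ℕ := ⌊1 / u⌋₊ with hN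
  set c : ℕ → ℝ := fun m ↦ 1 / ((m : ℝ) + 1) with hc
  have hc0 : ∀ m, 0 < c m := fun m ↦ by positivity
  -- the decomposition of the integrand on `(u, ∞)`
  have hdecomp : ∀ v ∈ Ioi u, Int.fract (1 / v) / v =
      v ^ (-2 : ℝ) - ∑ m ∈ Finset.range N, (Ioc (0 : ℝ) (c m)).indicator (fun w : ℝ ↦ w⁻¹) v := by
    intro v hv
    have hv0 : 0 < v := lt_trans hu hv
    have hfl : (⌊1 / v⌋₊ : ℝ) = ∑ m ∈ Finset.range N,
        (Ioc (0 : ℝ) 1).indicator (fun _ ↦ (1 : ℝ)) ((m + 1 : ℕ) * v) := by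
      rw [sum_indicator_Ioc_eq_floor' zero_le_one hv0]
      rw [hN]
      exact Nat.floor_le_floor (one_div_le_one_div_of_le hu hv.le)
    have hind : ∀ m : ℕ, (Ioc (0 : ℝ) 1).indicator (fun _ ↦ (1 : ℝ)) ((m + 1 : ℕ) * v) * v⁻¹ =
        (Ioc (0 : ℝ) (c m)).indicator (fun w : ℝ ↦ w⁻¹) v := by
      intro m
      have hm : (0 : ℝ) < (m : ℝ) + 1 := by positivity
      have hiff : ((m + 1 : ℕ) : ℝ) * v ∈ Ioc (0 : ℝ) 1 ↔ v ∈ Ioc (0 : ℝ) (c m) := by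
        rw [mem_Ioc, mem_Ioc, hc]
        push_cast
        rw [le_div_iff₀ hm, mul_comm]
        constructor
        · rintro ⟨-, h⟩; exact ⟨hv0, by linarith⟩
        · rintro ⟨-, h⟩; exact ⟨by positivity, by linarith⟩
      by_cases h : v ∈ Ioc (0 : ℝ) (c m)
      · rw [indicator_of_mem (hiff.2 h), indicator_of_mem h, one_mul]
      · rw [indicator_of_notMem (hiff.not.2 h), indicator_of_notMem h, zero_mul]
    rw [← Int.self_sub_floor, ← natCast_floor_eq_intCast_floor (by positivity), hfl, sub_div,
      div_eq_mul_inv (∑ m ∈ Finset.range N, _), Finset.sum_mul,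
      Finset.sum_congr rfl fun m _ ↦ hind m, Real.rpow_neg hv0.le, show (2 : ℝ) = (2 : ℕ) by norm_num,
      Real.rpow_natCast]
    field_simp
  -- integrability of the pieces on `(u, ∞)`
  have hint1 : IntegrableOn (fun v : ℝ ↦ v ^ (-2 : ℝ)) (Ioi u) :=
    integrableOn_Ioi_rpow_of_lt (by norm_num) hu
  have hset : ∀ m, Ioc (0 : ℝ) (c m) ∩ Ioi u = Ioc u (c m) := by
    intro m; ext v; constructor
    · rintro ⟨⟨-, h1⟩, h2⟩; exact ⟨h2, h1⟩
    · rintro ⟨h1, h2⟩; exact ⟨⟨lt_trans hu h1, h2⟩, h1⟩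
  have hint2 : ∀ m, IntegrableOn (fun v : ℝ ↦ (Ioc (0 : ℝ) (c m)).indicator (fun w : ℝ ↦ w⁻¹) v)
      (Ioi u) := by
    intro m
    rw [IntegrableOn, integrable_indicator_iff measurableSet_Ioc, IntegrableOn,
      Measure.restrict_restrict measurableSet_Ioc, hset m]
    have hcont : ContinuousOn (fun w : ℝ ↦ w⁻¹) (Icc u (c m)) :=
      continuousOn_inv₀.mono fun x hx ↦ (lt_of_lt_of_le hu hx.1).ne'
    exact hcont.integrableOn_Icc.mono_set Ioc_subset_Icc_self
  -- the values of the pieces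
  have hval1 : ∫ v in Ioi u, v ^ (-2 : ℝ) = 1 / u := by
    rw [integral_Ioi_rpow_of_lt (by norm_num) hu, show (-2 : ℝ) + 1 = -1 by norm_num,
      Real.rpow_neg_one]
    field_simp
  have hval2 : ∀ m ∈ Finset.range N,
      ∫ v in Ioi u, (Ioc (0 : ℝ) (c m)).indicator (fun w : ℝ ↦ w⁻¹) v =
        -Real.log ((m : ℝ) + 1) - Real.log u := by
    intro m hm
    have hm1 : (m : ℝ) + 1 ≤ N := by
      have : m + 1 ≤ N := Finset.mem_range.1 hm
      exact_mod_cast this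
    have hucm : u ≤ c m := by
      rw [hc, le_div_iff₀ (by positivity : (0 : ℝ) < (m : ℝ) + 1)]
      have hNu : (N : ℝ) * u ≤ 1 := by
        have := Nat.floor_le (div_nonneg zero_le_one hu.le : 0 ≤ 1 / u)
        rw [← hN] at this
        calc (N : ℝ) * u ≤ (1 / u) * u := mul_le_mul_of_nonneg_right this hu.le
          _ = 1 := by field_simp
      nlinarith
    rw [setIntegral_indicator measurableSet_Ioc, inter_comm, hset m,
      ← intervalIntegral.integral_of_le hucm,
      integral_inv_of_pos hu (hc0 m), Real.log_div (hc0 m).ne' hu.ne']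
    simp only [hc, one_div, Real.log_inv]
  -- assemble
  rw [setIntegral_congr_fun measurableSet_Ioi hdecomp,
    integral_sub hint1 (integrable_finsetSum _ fun m _ ↦ hint2 m), hval1,
    integral_finsetSum _ fun m _ ↦ hint2 m, Finset.sum_congr rfl hval2, Finset.sum_sub_distrib,
    Finset.sum_const, Finset.card_range, nsmul_eq_mul, Finset.sum_neg_distrib]
  have hlogfact : ∑ m ∈ Finset.range N, Real.log ((m : ℝ) + 1) = Real.log ((N.factorial : ℕ) : ℝ) := by
    rw [← Finset.prod_range_add_one_eq_factorial, Nat.cast_prod,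
      Real.log_prod (fun m _ ↦ by positivity)]
    push_cast
    rfl
  rw [hlogfact]
  ring

/-- **`A = V(−{1/u})` pointwise on `(0,∞)`**: for `u > 0`,
`A(u) = −{1/u} + ∫_u^∞ {1/v} dv/v` (for `u > 1` both sides vanish). This is the "straightforward
computation" behind `((s−1)/s)(ζ(s)/s) = ∫_0^1 A(u)u^{s−1} du`.
[cite: Burnol2001, §2 (before Thm 2.4), TeX l.396–400] -/
theorem fnA_eq {u : ℝ} (hu : 0 < u) :
    fnA u = -(((Int.fract (1 / u) : ℝ)) : ℂ) +
      ∫ v in Ioi u, (((Int.fract (1 / v) : ℝ)) : ℂ) / v := by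
  have hint : ∫ v in Ioi u, (((Int.fract (1 / v) : ℝ)) : ℂ) / v =
      ((∫ v in Ioi u, Int.fract (1 / v) / v : ℝ) : ℂ) := by
    rw [← integral_complex_ofReal]
    refine setIntegral_congr_fun measurableSet_Ioi fun v _ ↦ ?_
    push_cast
    rfl
  rw [hint, integral_Ioi_fract_div hu, fnA, ← Int.self_sub_floor,
    ← natCast_floor_eq_intCast_floor (by positivity : (0 : ℝ) ≤ 1 / u)]
  push_cast
  ring

/-! ## Mellin transforms: `{1/u}`, `A`, and the dilates of `A` -/

/-- `{1/t}` is measurable. [cite: Titchmarsh1986, §2.1 (2.1.5)] -/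
theorem measurable_fract_one_div : Measurable (fun t : ℝ ↦ ((Int.fract (1 / t) : ℝ) : ℂ)) :=
  Complex.measurable_ofReal.comp (measurable_fract.comp (measurable_const.div measurable_id))

/-- **`Â(s) = (s−1)ζ(s)/s²` on `0 < Re s < 1`** (Burnol: `((s−1)/s)·(ζ(s)/s) = ∫_0^1 A(u)u^{s−1} du`;
`A` vanishes on `(1,∞)`): `A = −{1/u} + ∫_u^∞ {1/v}dv/v`, `∫_0^∞ {1/t}t^{s−1} dt = −ζ(s)/s`
(`mellin_fract_one_div_eq`, convergence `BaezDuarteOnlyIf.mellinConvergent_fract_one_div`) and the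
spectral action of `V` (`hasMellin_integral_Ioi_div`).
[cite: Burnol2001, §2 (before Thm 2.4), TeX l.396–400] -/
theorem hasMellin_fnA {s : ℂ} (hs0 : 0 < s.re) (hs1 : s.re < 1) :
    HasMellin fnA s ((s - 1) * riemannZeta s / s ^ 2) := by
  have hs : s ≠ 0 := fun h ↦ by simp [h] at hs0
  have hF : MellinConvergent (fun t : ℝ ↦ ((Int.fract (1 / t) : ℝ) : ℂ)) s :=
    BaezDuarteOnlyIf.mellinConvergent_fract_one_div hs0 hs1
  have hW := hasMellin_integral_Ioi_div hs0 measurable_fract_one_div.aestronglyMeasurable hF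
  have hneg : HasMellin (fun t : ℝ ↦ -(((Int.fract (1 / t) : ℝ)) : ℂ)) s
      (-mellin (fun t : ℝ ↦ ((Int.fract (1 / t) : ℝ) : ℂ)) s) := by
    refine ⟨?_, ?_⟩
    · have := hF.neg
      refine this.congr ?_
      exact Eventually.of_forall fun t ↦ by simp
    · rw [mellin, mellin, ← integral_neg]
      refine integral_congr_ae (Eventually.of_forall fun t ↦ by simp)
  have hsum := hasMellin_add hneg.1 hW.1
  rw [hneg.2, hW.2, mellin_fract_one_div_eq hs0 hs1] at hsum
  refine ⟨hsum.1.congr_fun (fun t ht ↦ by simp only [fnA_eq (show 0 < t from ht)])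
    measurableSet_Ioi, ?_⟩
  rw [show mellin fnA s = mellin (fun t : ℝ ↦ -(((Int.fract (1 / t) : ℝ)) : ℂ) +
      ∫ v in Ioi t, (((Int.fract (1 / v) : ℝ)) : ℂ) / v) s from
    setIntegral_congr_fun measurableSet_Ioi (fun t ht ↦ by rw [fnA_eq ht]), hsum.2]
  field_simp
  ring

/-- `A` is measurable. [cite: Burnol2001, §2 (before Thm 2.4)] -/
theorem measurable_fnA : Measurable fnA := by
  have hfl : Measurable (fun u : ℝ ↦ ⌊1 / u⌋₊) :=
    Nat.measurable_floor.comp (measurable_const.div measurable_id)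
  have h1 : Measurable (fun u : ℝ ↦ (⌊1 / u⌋₊ : ℝ)) :=
    (measurable_from_nat (f := fun n : ℕ ↦ (n : ℝ))).comp hfl
  have h2 : Measurable (fun u : ℝ ↦ Real.log ((⌊1 / u⌋₊.factorial : ℕ) : ℝ)) :=
    (measurable_from_nat (f := fun n : ℕ ↦ Real.log ((n.factorial : ℕ) : ℝ))).comp hfl
  unfold fnA
  exact Complex.measurable_ofReal.comp (((h1.mul Real.measurable_log).add h2).add h1)

/-- `A` vanishes on `(1, ∞)` (`[1/u] = 0` there). [cite: Burnol2001, §2 (before Thm 2.4)] -/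
theorem fnA_eq_zero_of_one_lt {u : ℝ} (hu : 1 < u) : fnA u = 0 := by
  have hfl : ⌊1 / u⌋₊ = 0 := by
    rw [Nat.floor_eq_zero, div_lt_one (by linarith)]; exact hu
  rw [fnA, hfl]
  simp

/-- **Mellin transform of a dilate `U(λ)A`, `0 < λ ≤ 1`, at a zero of `ζ` in the strip**:
`∫_0^∞ (U(λ)A)(u) u^{s−1} du = λ^{−1/2}·λ^{s}·Â(s) = 0`. [cite: Burnol2001, §2 (before Thm 2.4);
Thm 2.4] -/
theorem hasMellin_dilate_fnA_zero {lam : ℝ} (hlam : 0 < lam) {s : ℂ} (hs0 : 0 < s.re)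
    (hs1 : s.re < 1) (hζ : riemannZeta s = 0) : HasMellin (dilate lam fnA) s 0 := by
  have hA := hasMellin_fnA hs0 hs1
  rw [hζ, mul_zero, zero_div] at hA
  have hfun : dilate lam fnA = fun u ↦ (Real.sqrt (1 / lam) : ℂ) • fnA (lam⁻¹ * u) := by
    funext u
    simp only [dilate, smul_eq_mul, div_eq_inv_mul]
  rw [hfun]
  have hconv : MellinConvergent (fun u : ℝ ↦ fnA (lam⁻¹ * u)) s :=
    (MellinConvergent.comp_mul_left (inv_pos.2 hlam)).2 hA.1
  have hval : mellin (fun u : ℝ ↦ fnA (lam⁻¹ * u)) s = 0 := by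
    rw [mellin_comp_mul_left _ _ (inv_pos.2 hlam), hA.2, smul_zero]
  have h := hasMellin_const_smul hconv (Real.sqrt (1 / lam) : ℂ)
  rw [hval, smul_zero] at h
  exact h

end Burnol2001

open Burnol2001

/-! ## The door: dilates of `A` span `L²(0,1)` ⟹ RH -/

/-- **Burnol 2001, Thm 2.4, the RH-FREE half (`⟸`).** If every `g ∈ L²((0,1))` is an
`L²((0,1))`-limit of finite combinations of the dilates `U(λ)A`, `0 < λ ≤ 1` — the right-hand side
of `Literature.NumberTheory.LFunctions.Burnol2001_thm_2_4` verbatim — then the Riemann hypothesis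
holds. Proof as printed for Nyman's theorem: at a zero `s₀` of `ζ` with `½ < Re s₀ < 1` each
dilate is Mellin-orthogonal to `u^{s₀−1}` (`hasMellin_dilate_fnA_zero`, from
`Â(s) = (s−1)ζ(s)/s²`), while for `g = 𝟏`, `∫_0^1 u^{s₀−1} du = 1/s₀ ≠ 0`; Cauchy–Schwarz and
`ε → 0`; `quasiRiemannHypothesis_one_half_iff_holds` excludes zeros left of the line. The
converse half (RH ⟹ span, via "`(s−1)ζ(s)/s²` is outer") is NOT proved here (boundary F8).
[cite: Burnol2001, Thm 2.4 (arXiv v3 l.407–410)] -/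
theorem riemannHypothesis_of_dilate_fnA_closure
    (h : ∀ g : ℝ → ℂ, MemLp g 2 (volume.restrict (Ioo (0 : ℝ) 1)) →
      ∀ ε : ℝ, 0 < ε → ∃ (n : ℕ) (lam : Fin n → ℝ) (c : Fin n → ℂ), (∀ i, 0 < lam i ∧ lam i ≤ 1) ∧
        eLpNorm (fun u : ℝ ↦ g u - ∑ i, c i * dilate (lam i) fnA u) 2
          (volume.restrict (Ioo (0 : ℝ) 1)) < ENNReal.ofReal ε) :
    RiemannHypothesis := by
  -- specialise to `g = 𝟏`
  haveI : IsFiniteMeasure (volume.restrict (Ioo (0 : ℝ) 1)) :=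
    ⟨by rw [Measure.restrict_apply_univ]; exact measure_Ioo_lt_top⟩
  have h1 := h (fun _ ↦ (1 : ℂ)) (memLp_const 1)
  refine quasiRiemannHypothesis_one_half_iff_holds.1 fun s hζ hσ hσ1 ↦ ?_
  set μ0 : Measure ℝ := volume.restrict (Ioi 0) with hμ0
  have hre : 0 < s.re := by linarith
  have hs0 : s ≠ 0 := fun h0 ↦ by simp [h0] at hre
  have hs1 : s ≠ 1 := fun h1' ↦ by simp [h1'] at hσ1
  -- the test function `g = 𝟙_{(0,1]} x^{s-1}` and its (finite) `L²` norm `M`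
  set g : ℝ → ℂ := (Ioc (0 : ℝ) 1).indicator fun x ↦ (x : ℂ) ^ (s - 1) with hg
  have hgm : AEStronglyMeasurable g μ0 := by
    refine (Measurable.indicator ?_ measurableSet_Ioc).aestronglyMeasurable
    exact Complex.measurable_ofReal.pow_const _
  have hgL2 : MemLp g 2 μ0 := by
    refine (memLp_two_iff_integrable_sq_norm hgm).2 ?_
    have hI : IntegrableOn (fun x : ℝ ↦ x ^ (2 * (s.re - 1))) (Ioc 0 1) μ0 :=
      (intervalIntegral.intervalIntegrable_rpow' (a := 0) (b := 1) (by linarith)).1.restrict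
    refine (hI.integrable_indicator measurableSet_Ioc).congr ?_
    filter_upwards [ae_restrict_mem measurableSet_Ioi] with x (hx : 0 < x)
    by_cases hx1 : x ∈ Ioc (0 : ℝ) 1
    · simp only [hg, indicator_of_mem hx1, norm_cpow_eq_rpow_re_of_pos hx, sub_re, one_re]
      rw [← Real.rpow_natCast, ← Real.rpow_mul hx.le]
      norm_num [mul_comm]
    · simp [hg, indicator_of_notMem hx1]
  set M : ℝ := (eLpNorm g 2 μ0).toReal with hM
  have hM0 : 0 ≤ M := ENNReal.toReal_nonneg
  -- Key estimate: for every `ε > 0`, `‖1/s‖ ≤ ε M`.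
  have key : ∀ ε : ℝ, 0 < ε → ‖(1 : ℂ) / s‖ ≤ ε * M := by
    intro ε hε
    obtain ⟨n, lam, c, hlam, hN⟩ := h1 ε hε
    set D : ℝ → ℂ := fun u ↦ (1 : ℂ) - ∑ i, c i * dilate (lam i) fnA u with hD
    have hDm : Measurable D := by
      refine measurable_const.sub (Finset.measurable_sum _ fun i _ ↦ measurable_const.mul ?_)
      exact (measurable_const.mul (measurable_fnA.comp (measurable_id.div_const (lam i))) :
        Measurable fun x : ℝ ↦ (Real.sqrt (1 / lam i) : ℂ) * fnA (x / lam i))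
    set Dc : ℝ → ℂ := (Ioc (0 : ℝ) 1).indicator D with hDc
    have hDcm : Measurable Dc := hDm.indicator measurableSet_Ioc
    ------------------------------------------------------------------
    -- (i) `‖Dc‖_{L²(0,∞)} = ‖D‖_{L²(0,1)} < ε`
    ------------------------------------------------------------------
    have hDc2 : eLpNorm Dc 2 μ0 < ENNReal.ofReal ε := by
      have h1 : eLpNorm Dc 2 μ0 = eLpNorm D 2 (volume.restrict (Ioo (0 : ℝ) 1)) := by
        rw [hDc, eLpNorm_indicator_eq_eLpNorm_restrict measurableSet_Ioc, hμ0,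
          Measure.restrict_restrict measurableSet_Ioc, inter_eq_left.2 Ioc_subset_Ioi_self,
          Measure.restrict_congr_set (Ioo_ae_eq_Ioc (μ := (volume : Measure ℝ)) (a := 0) (b := 1))]
      rw [h1]; exact hN
    ------------------------------------------------------------------
    -- (ii) the pairing with `x^{s-1}` on `(0,1]` equals `1/s`
    ------------------------------------------------------------------
    have hI : ∫ x in Ioi (0 : ℝ), (x : ℂ) ^ (s - 1) • Dc x = 1 / s := by
      have hlin : ∀ x ∈ Ioi (0 : ℝ), (x : ℂ) ^ (s - 1) • Dc x =
          (x : ℂ) ^ (s - 1) • (Ioc (0 : ℝ) 1).indicator (fun _ ↦ (1 : ℂ)) x -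
            ∑ i, c i * ((x : ℂ) ^ (s - 1) • dilate (lam i) fnA x) := by
        intro x hx
        by_cases hx1 : x ∈ Ioc (0 : ℝ) 1
        · simp only [hDc, hD, indicator_of_mem hx1, smul_eq_mul, mul_sub, Finset.mul_sum]
          congr 1
          exact Finset.sum_congr rfl fun i _ ↦ by ring
        · have hx1' : 1 < x := by
            rw [mem_Ioc, not_and, not_le] at hx1; exact hx1 hx
          have hzero : ∀ i, dilate (lam i) fnA x = 0 := by
            intro i
            simp only [dilate]
            rw [fnA_eq_zero_of_one_lt, mul_zero]
            rw [lt_div_iff₀ (hlam i).1]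
            linarith [(hlam i).2]
          simp only [hDc, indicator_of_notMem hx1, smul_zero, hzero, smul_zero, mul_zero,
            Finset.sum_const_zero, sub_zero]
      have hint1 : Integrable (fun x : ℝ ↦ (x : ℂ) ^ (s - 1) •
          (Ioc (0 : ℝ) 1).indicator (fun _ ↦ (1 : ℂ)) x) μ0 := (hasMellin_one_Ioc hre).1
      have hmel : ∀ i, HasMellin (dilate (lam i) fnA) s 0 :=
        fun i ↦ hasMellin_dilate_fnA_zero (hlam i).1 hre hσ1 hζ
      have hint2 : ∀ i, Integrable (fun x : ℝ ↦ c i *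
          ((x : ℂ) ^ (s - 1) • dilate (lam i) fnA x)) μ0 :=
        fun i ↦ (hmel i).1.const_mul _
      rw [setIntegral_congr_fun measurableSet_Ioi hlin,
        integral_sub hint1 (integrable_finsetSum _ fun i _ ↦ hint2 i),
        integral_finsetSum _ fun i _ ↦ hint2 i]
      have h1 : ∫ x in Ioi (0 : ℝ), (x : ℂ) ^ (s - 1) •
          (Ioc (0 : ℝ) 1).indicator (fun _ ↦ (1 : ℂ)) x = 1 / s := (hasMellin_one_Ioc hre).2
      have h2 : ∀ i, ∫ x in Ioi (0 : ℝ), (x : ℂ) ^ (s - 1) • dilate (lam i) fnA x = 0 :=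
        fun i ↦ (hmel i).2
      rw [h1, Finset.sum_congr rfl fun i _ ↦
        (integral_const_mul _ _).trans (congrArg (fun z ↦ c i * z) (h2 i))]
      simp
    ------------------------------------------------------------------
    -- (iii) Cauchy–Schwarz on `(0,1]`: the pairing has norm `≤ ε M`
    ------------------------------------------------------------------
    have hIle : ‖∫ x in Ioi (0 : ℝ), (x : ℂ) ^ (s - 1) • Dc x‖ ≤ ε * M := by
      have hprod : (fun x : ℝ ↦ (x : ℂ) ^ (s - 1) • Dc x) = Dc • g := by
        funext x
        simp only [Pi.smul_apply', smul_eq_mul, hDc, hg]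
        by_cases hx : x ∈ Ioc (0 : ℝ) 1
        · simp only [indicator_of_mem hx]; ring
        · simp only [indicator_of_notMem hx, mul_zero]
      have hH : eLpNorm (Dc • g) 1 μ0 ≤ ENNReal.ofReal ε * eLpNorm g 2 μ0 :=
        (eLpNorm_smul_le_mul_eLpNorm hgm hDcm.aestronglyMeasurable).trans (by gcongr)
      have hfin : ENNReal.ofReal ε * eLpNorm g 2 μ0 ≠ ⊤ :=
        ENNReal.mul_ne_top ENNReal.ofReal_ne_top hgL2.eLpNorm_lt_top.ne
      calc ‖∫ x in Ioi (0 : ℝ), (x : ℂ) ^ (s - 1) • Dc x‖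
          ≤ (∫⁻ x in Ioi (0 : ℝ), ENNReal.ofReal ‖(x : ℂ) ^ (s - 1) • Dc x‖).toReal :=
            norm_integral_le_lintegral_norm _
        _ = (eLpNorm (Dc • g) 1 μ0).toReal := by
            rw [← hprod, eLpNorm_one_eq_lintegral_enorm]
            simp_rw [ofReal_norm]
            rfl
        _ ≤ (ENNReal.ofReal ε * eLpNorm g 2 μ0).toReal := ENNReal.toReal_mono hfin hH
        _ = ε * M := by rw [ENNReal.toReal_mul, ENNReal.toReal_ofReal hε.le]
    rw [← hI]
    exact hIle
  -- Conclusion: `‖1/s‖ = 0`, absurd.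
  have hpos : 0 < ‖(1 : ℂ) / s‖ := norm_pos_iff.2 (one_div_ne_zero hs0)
  have := key (‖(1 : ℂ) / s‖ / (2 * (M + 1))) (by positivity)
  have hlt : ‖(1 : ℂ) / s‖ / (2 * (M + 1)) * M < ‖(1 : ℂ) / s‖ := by
    rw [div_mul_eq_mul_div, div_lt_iff₀ (by positivity)]
    nlinarith
  linarith

/-- The same door phrased on the named fact: the right-hand side of `Burnol2001_thm_2_4` implies
`RiemannHypothesis` (so the fact's content beyond this file is exactly its `⟹` half).
[cite: Burnol2001, Thm 2.4 (arXiv v3 l.407–410)] -/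
theorem Burnol2001_thm_2_4_mpr :
    (∀ g : ℝ → ℂ, MemLp g 2 (volume.restrict (Ioo (0 : ℝ) 1)) →
      ∀ ε : ℝ, 0 < ε → ∃ (n : ℕ) (lam : Fin n → ℝ) (c : Fin n → ℂ), (∀ i, 0 < lam i ∧ lam i ≤ 1) ∧
        eLpNorm (fun u : ℝ ↦ g u - ∑ i, c i * dilate (lam i) fnA u) 2
          (volume.restrict (Ioo (0 : ℝ) 1)) < ENNReal.ofReal ε) → RiemannHypothesis :=
  riemannHypothesis_of_dilate_fnA_closure

end Literature.NumberTheory.LFunctions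

end
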